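import Literature.NumberTheory.GaloisRepresentations.OddSubgroupCartanNormalizerGL2Fp
import Literature.NumberTheory.Automorphic.TotallyRealModularityQuarticSixteenCurves
import Literature.NumberTheory.Automorphic.FLSModFiveImageSqrtFive
import Summits.Langlands.Langlands.Theorems.SqrtFiveQuarticCoversGroupCensusFiveCases
import Summits.Langlands.Langlands.Theses.SqrtFiveQuarticCovers

/-!
# `SqrtFiveQuarticCovers.GroupCensusFive` holds (item stmt-Langlands-17592) — case A and assembly

Route `Langlands/SqrtFiveQuarticCovers`, support item `GroupCensusFive` ("USED BY `closes`: it turns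
the Cartan data of `ReductionToRefinedLocus` into the `H8`/`H12` framing of `RefinedLocusModular`"):

> every subgroup `G ≤ GL₂(𝔽₅)` with `det G ⊆ {±1}`, containing an element of trace `0` and
> determinant `-1`, acting irreducibly on `𝔽₅²`, whose determinant-one part does not span `M₂(𝔽₅)`,
> is conjugate into `H8 = ⟨diag(2,3), antidiag(1,1)⟩` or into `H12 = ⟨(3 1;3 3), diag(1,4)⟩`

(Freitas–Le Hung–Siksek 2015, Remark (iii) after Cor. 2.1: "we obtain three subgroups of
`GL₂(𝔽₅)` of orders `6`, `8` and `12`").  PROVED here, sorry-free and unconditionally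
(`groupCensusFive_proof`, type = the route declaration verbatim), by a STRUCTURED argument rather
than an enumeration of the subgroups of the `480`-element group:

1. a non-scalar `g₀ ∈ G ∩ SL₂(𝔽₅)` exists (tree: `FLS2015.exists_det_eq_one_ne_smul_one` — else `G`
   is abelian, commutes with the involution `c`, and fixes a line);
2. rational canonical form of `g₀` and transport of the hypotheses along the conjugation
   (`…GroupCensusFiveLemmas`);
3. by `tr g₀`: `0` ↦ `H8` (case B), `2, 3` ↦ impossible (case C) (`…GroupCensusFiveCases`), and
   `1, 4` ↦ `H12` (**case A**, this file: `𝔽₅[g₀] ≅ 𝔽₂₅`; the annihilating functional of (d) forces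
   `G ∩ SL₂ ≤ 𝔽₅[g₀]ˣ`, i.e. into the norm-one group `C₆`; the odd element normalises it as a
   Frobenius-coset involution; an explicit matrix conjugates the resulting dihedral group of order
   `12` onto `H12`).

Every residual finite check is a `decide` over at most six elements of `ZMod 5` (two of them with
the `+kernel` option, `5⁶` cases).  No definitions; standard axioms only.
References: [FreitasLeHungSiksek2015] N. Freitas, B. V. Le Hung, S. Siksek, Invent. Math. 201
(2015) 159–206, Remark (iii) after Cor. 2.1 (held text arXiv:1310.7088 p. 20) and Lemma 3.2.
-/

set_option linter.dupNamespace false -- project-wide option (lakefile weak.linter.dupNamespace); `Summit.Langlands.Langlands` is the mandated namespace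

namespace Summit.Langlands.Langlands.Theorems.GroupCensusFive

open Matrix

/-- Pure `2 × 2` algebra used in case A: if `X P X⁻¹` commutes with `A` and `X C₀ X⁻¹ F` commutes
with `A`, then `X (P C₀) X⁻¹ F = (X P X⁻¹)(X C₀ X⁻¹ F)` commutes with `A`. [folklore] -/
theorem conj_mul_comm_of_parts (X Xi P C₀ F A : Matrix (Fin 2) (Fin 2) (ZMod 5)) (hXiX : Xi * X = 1)
    (hU : X * P * Xi * A = A * (X * P * Xi))
    (hV : X * C₀ * Xi * F * A = A * (X * C₀ * Xi * F)) :
    X * (P * C₀) * Xi * F * A = A * (X * (P * C₀) * Xi * F) := by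
  have e : X * P * Xi * (X * C₀ * Xi * F) = X * (P * C₀) * Xi * F := by
    calc X * P * Xi * (X * C₀ * Xi * F) = X * P * (Xi * X) * C₀ * Xi * F := by
          simp only [Matrix.mul_assoc]
      _ = X * (P * C₀) * Xi * F := by rw [hXiX]; simp only [Matrix.mul_one, Matrix.mul_assoc]
  rw [← e]
  calc X * P * Xi * (X * C₀ * Xi * F) * A = X * P * Xi * (X * C₀ * Xi * F * A) := by
        simp only [Matrix.mul_assoc]
    _ = X * P * Xi * (A * (X * C₀ * Xi * F)) := by rw [hV]
    _ = X * P * Xi * A * (X * C₀ * Xi * F) := by simp only [Matrix.mul_assoc]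
    _ = A * (X * P * Xi) * (X * C₀ * Xi * F) := by rw [hU]
    _ = A * (X * P * Xi * (X * C₀ * Xi * F)) := by simp only [Matrix.mul_assoc]

/-! ## 8. Case A: an element of `G ∩ SL₂` with irreducible characteristic polynomial — `H12` -/

/-- **Case `tr g₀ ∈ {1, 4}`.** If `G` (hypotheses (a), (b), (d) — (d) as a functional) contains `n`
with matrix the companion matrix `C = (0 4; 1 t)` of `X² - tX + 1`, `t ∈ {1, 4}` (irreducible
over `𝔽₅`, `𝔽₅[C] ≅ 𝔽₂₅`), then `G` is conjugate into `H12`: every `h ∈ G ∩ SL₂` commutes with `C`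
(else `1, C, h, Ch` span `M₂(𝔽₅)`, killing the functional), so `G ∩ SL₂ ≤ 𝔽₅[C]ˣ ∩ SL₂ ≅ C₆`; the
odd element `c` normalises it and is a Frobenius-coset involution; an explicit `x` conjugates
`𝔽₅[C]` onto `𝔽₅[a]`, `a = (3 1;3 3)`, and `c` into `⟨a⟩·f`. [cite: FreitasLeHungSiksek2015, Remark (iii) after Cor. 2.1] -/
theorem caseA {G : Subgroup (GL (Fin 2) (ZMod 5))}
    (hdet : ∀ g ∈ G, Matrix.det ((g : GL (Fin 2) (ZMod 5)) : Matrix (Fin 2) (Fin 2) (ZMod 5)) = 1 ∨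
      Matrix.det ((g : GL (Fin 2) (ZMod 5)) : Matrix (Fin 2) (Fin 2) (ZMod 5)) = -1)
    {c : GL (Fin 2) (ZMod 5)} (hcG : c ∈ G)
    (hctr : Matrix.trace (c : Matrix (Fin 2) (Fin 2) (ZMod 5)) = 0)
    (hcdet : Matrix.det (c : Matrix (Fin 2) (Fin 2) (ZMod 5)) = -1)
    {φ : Matrix (Fin 2) (Fin 2) (ZMod 5) →ₗ[ZMod 5] ZMod 5} (hφ0 : φ ≠ 0)
    (hφ : ∀ g ∈ G, Matrix.det (g : Matrix (Fin 2) (Fin 2) (ZMod 5)) = 1 →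
      φ (g : Matrix (Fin 2) (Fin 2) (ZMod 5)) = 0)
    {t : ZMod 5} (ht : t = 1 ∨ t = 4)
    {n : GL (Fin 2) (ZMod 5)} (hnG : n ∈ G) (hn : (n : Matrix (Fin 2) (Fin 2) (ZMod 5)) = !![0, 4; 1, t]) :
    ∃ x : GL (Fin 2) (ZMod 5), (∀ g ∈ G, x * g * x⁻¹ ∈ Subgroup.closure ({(⟨!![2, 0; 0, 3], !![3, 0; 0, 2], by decide, by decide⟩ : GL (Fin 2) (ZMod 5)), (⟨!![0, 1; 1, 0], !![0, 1; 1, 0], by decide, by decide⟩ : GL (Fin 2) (ZMod 5))} : Set (GL (Fin 2) (ZMod 5)))) ∨ (∀ g ∈ G, x * g * x⁻¹ ∈ Subgroup.closure ({(⟨!![3, 1; 3, 3], !![3, 4; 2, 3], by decide, by decide⟩ : GL (Fin 2) (ZMod 5)), (⟨!![1, 0; 0, 4], !![1, 0; 0, 4], by decide, by decide⟩ : GL (Fin 2) (ZMod 5))} : Set (GL (Fin 2) (ZMod 5)))) := by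
  have hcc := mul_self_eq_one_of_trace_zero c hctr hcdet
  have hndet : Matrix.det (n : Matrix (Fin 2) (Fin 2) (ZMod 5)) = 1 := by
    rw [hn, Matrix.det_fin_two_of]; ring_nf; decide
  have hw : ¬ (φ !![1, 0; 0, 0] = 0 ∧ φ !![0, 1; 0, 0] = 0 ∧ φ !![0, 0; 1, 0] = 0 ∧ φ !![0, 0; 0, 1] = 0) :=
    fun h => hφ0 (functional_eq_zero φ h)
  have e1 := hφ 1 G.one_mem (by simp)
  have en := hφ n hnG hndet
  rw [functional_apply] at e1 en
  rw [hn] at en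
  simp only [Units.val_one, Matrix.one_apply_eq, Matrix.one_apply_ne, ne_eq, zero_ne_one,
    one_ne_zero, not_false_eq_true, Matrix.of_apply, Matrix.cons_val', Matrix.cons_val_zero,
    Matrix.cons_val_one, Matrix.cons_val_fin_one, Matrix.empty_val'] at e1 en
  -- A1: every determinant-one element of `G` commutes with `C`
  have hcomm : ∀ h ∈ G, Matrix.det ((h : GL (Fin 2) (ZMod 5)) : Matrix (Fin 2) (Fin 2) (ZMod 5)) = 1 →
      ((h : GL (Fin 2) (ZMod 5)) : Matrix (Fin 2) (Fin 2) (ZMod 5)) * !![0, 4; 1, t] =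
        !![0, 4; 1, t] * ((h : GL (Fin 2) (ZMod 5)) : Matrix (Fin 2) (Fin 2) (ZMod 5)) := by
    intro h hh hhd
    obtain ⟨p, q, r, s, hh'⟩ := exists_eq_fin_two (h : Matrix (Fin 2) (Fin 2) (ZMod 5))
    have eh := hφ h hh hhd
    have enh := hφ (n * h) (G.mul_mem hnG hh)
      (by rw [Units.val_mul, Matrix.det_mul, hndet, hhd, one_mul])
    rw [functional_apply] at eh enh
    rw [Units.val_mul, hn, hh'] at enh
    rw [hh'] at eh ⊢
    simp only [Matrix.mul_fin_two, Matrix.of_apply, Matrix.cons_val', Matrix.cons_val_zero,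
      Matrix.cons_val_one, Matrix.cons_val_fin_one, Matrix.empty_val'] at eh enh ⊢
    generalize φ !![1, 0; 0, 0] = w00 at hw e1 en eh enh
    generalize φ !![0, 1; 0, 0] = w01 at hw e1 en eh enh
    generalize φ !![0, 0; 1, 0] = w10 at hw e1 en eh enh
    generalize φ !![0, 0; 0, 1] = w11 at hw e1 en eh enh
    have hw1 : w00 = -w11 ∧ w10 = w01 - t * w11 := by
      clear eh enh hw hh' hn hndet
      rcases ht with rfl | rfl
      · revert w00 w01 w10 w11 e1 en; decide
      · revert w00 w01 w10 w11 e1 en; decide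
    obtain ⟨rfl, rfl⟩ := hw1
    clear e1 en hh' hh hhd hn hndet
    rcases ht with rfl | rfl
    · revert p q r s w01 w11 hw eh enh; decide +kernel
    · revert p q r s w01 w11 hw eh enh; decide +kernel
  -- A2: the odd element `c`: `c n c⁻¹ = c n c ∈ G ∩ SL₂` commutes with `C`
  have hcnc := hcomm (c * n * c) (G.mul_mem (G.mul_mem hcG hnG) hcG)
    (by rw [Units.val_mul, Units.val_mul, Matrix.det_mul, Matrix.det_mul, hcdet, hndet]; norm_num)
  rw [Units.val_mul, Units.val_mul, hn] at hcnc
  obtain ⟨c1, c2, c3, c4, hc⟩ := exists_eq_fin_two (c : Matrix (Fin 2) (Fin 2) (ZMod 5))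
  have hctr' := hctr
  have hcdet' := hcdet
  rw [hc, Matrix.trace_fin_two_of] at hctr'
  rw [hc, Matrix.det_fin_two_of] at hcdet'
  rw [hc] at hcnc
  simp only [Matrix.mul_fin_two] at hcnc
  -- A3: conclusion, with the explicit conjugator `x_t`
  rcases ht with rfl | rfl
  · -- t = 1: x = (0 1; 1 3), x⁻¹ = (2 1; 1 0)
    have hV : (!![0, 1; 1, 3] : Matrix (Fin 2) (Fin 2) (ZMod 5)) * !![c1, c2; c3, c4] * !![2, 1; 1, 0] *
        !![1, 0; 0, 4] * !![3, 1; 3, 3] =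
        !![3, 1; 3, 3] * ((!![0, 1; 1, 3] : Matrix (Fin 2) (Fin 2) (ZMod 5)) * !![c1, c2; c3, c4] *
          !![2, 1; 1, 0] * !![1, 0; 0, 4]) := by
      simp only [Matrix.mul_fin_two]
      clear hc hcomm hw hcc
      revert c1 c2 c3 c4 hctr' hcdet' hcnc; decide
    refine ⟨⟨!![0, 1; 1, 3], !![2, 1; 1, 0], by decide, by decide⟩, Or.inr fun g hg => ?_⟩
    apply mem_H12_of_shape
    rcases hdet g hg with hd | hd
    · left
      refine ⟨?_, by rw [Units.val_mul, Units.val_mul, Matrix.det_units_conj]; exact hd⟩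
      have hg1 := hcomm g hg hd
      obtain ⟨p, q, r, s, hg'⟩ := exists_eq_fin_two (g : Matrix (Fin 2) (Fin 2) (ZMod 5))
      rw [hg', Matrix.det_fin_two_of] at hd
      rw [hg'] at hg1
      rw [Units.val_mul, Units.val_mul, hg']
      change (!![0, 1; 1, 3] : Matrix (Fin 2) (Fin 2) (ZMod 5)) * !![p, q; r, s] * !![2, 1; 1, 0] * !![3, 1; 3, 3] =
        !![3, 1; 3, 3] * ((!![0, 1; 1, 3] : Matrix (Fin 2) (Fin 2) (ZMod 5)) * !![p, q; r, s] * !![2, 1; 1, 0])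
      simp only [Matrix.mul_fin_two] at hg1 ⊢
      clear hg' hV hc hcnc hcomm hw
      revert p q r s hd hg1; decide
    · right
      refine ⟨?_, by rw [Units.val_mul, Units.val_mul, Matrix.det_units_conj]; exact hd⟩
      have hgc1 : Matrix.det ((g * c : GL (Fin 2) (ZMod 5)) : Matrix (Fin 2) (Fin 2) (ZMod 5)) = 1 :=
        det_mul_eq_one_of_det_eq_neg_one hd hcdet
      have hU := hcomm (g * c) (G.mul_mem hg hcG) hgc1
      obtain ⟨p, q, r, s, hgc⟩ := exists_eq_fin_two ((g * c : GL (Fin 2) (ZMod 5)) : Matrix (Fin 2) (Fin 2) (ZMod 5))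
      rw [hgc, Matrix.det_fin_two_of] at hgc1
      rw [hgc] at hU
      have hU' : (!![0, 1; 1, 3] : Matrix (Fin 2) (Fin 2) (ZMod 5)) * !![p, q; r, s] * !![2, 1; 1, 0] * !![3, 1; 3, 3] =
          !![3, 1; 3, 3] * ((!![0, 1; 1, 3] : Matrix (Fin 2) (Fin 2) (ZMod 5)) * !![p, q; r, s] * !![2, 1; 1, 0]) := by
        simp only [Matrix.mul_fin_two] at hU ⊢
        clear hgc hV hc hcnc hcomm hw
        revert p q r s hgc1 hU; decide
      have hg' : (g : Matrix (Fin 2) (Fin 2) (ZMod 5)) = !![p, q; r, s] * !![c1, c2; c3, c4] := by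
        rw [← hgc, ← hc, ← Units.val_mul, mul_assoc, hcc, mul_one]
      rw [Units.val_mul, Units.val_mul, hg']
      change (!![0, 1; 1, 3] : Matrix (Fin 2) (Fin 2) (ZMod 5)) * (!![p, q; r, s] * !![c1, c2; c3, c4]) * !![2, 1; 1, 0] *
          !![1, 0; 0, 4] * !![3, 1; 3, 3] =
        !![3, 1; 3, 3] * ((!![0, 1; 1, 3] : Matrix (Fin 2) (Fin 2) (ZMod 5)) * (!![p, q; r, s] * !![c1, c2; c3, c4]) *
          !![2, 1; 1, 0] * !![1, 0; 0, 4])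
      exact conj_mul_comm_of_parts _ _ _ _ _ _ (by decide) hU' hV
  · -- t = 4: x = (0 1; 1 2), x⁻¹ = (3 1; 1 0)
    have hV : (!![0, 1; 1, 2] : Matrix (Fin 2) (Fin 2) (ZMod 5)) * !![c1, c2; c3, c4] * !![3, 1; 1, 0] *
        !![1, 0; 0, 4] * !![3, 1; 3, 3] =
        !![3, 1; 3, 3] * ((!![0, 1; 1, 2] : Matrix (Fin 2) (Fin 2) (ZMod 5)) * !![c1, c2; c3, c4] *
          !![3, 1; 1, 0] * !![1, 0; 0, 4]) := by
      simp only [Matrix.mul_fin_two]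
      clear hc hcomm hw hcc
      revert c1 c2 c3 c4 hctr' hcdet' hcnc; decide
    refine ⟨⟨!![0, 1; 1, 2], !![3, 1; 1, 0], by decide, by decide⟩, Or.inr fun g hg => ?_⟩
    apply mem_H12_of_shape
    rcases hdet g hg with hd | hd
    · left
      refine ⟨?_, by rw [Units.val_mul, Units.val_mul, Matrix.det_units_conj]; exact hd⟩
      have hg1 := hcomm g hg hd
      obtain ⟨p, q, r, s, hg'⟩ := exists_eq_fin_two (g : Matrix (Fin 2) (Fin 2) (ZMod 5))
      rw [hg', Matrix.det_fin_two_of] at hd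
      rw [hg'] at hg1
      rw [Units.val_mul, Units.val_mul, hg']
      change (!![0, 1; 1, 2] : Matrix (Fin 2) (Fin 2) (ZMod 5)) * !![p, q; r, s] * !![3, 1; 1, 0] * !![3, 1; 3, 3] =
        !![3, 1; 3, 3] * ((!![0, 1; 1, 2] : Matrix (Fin 2) (Fin 2) (ZMod 5)) * !![p, q; r, s] * !![3, 1; 1, 0])
      simp only [Matrix.mul_fin_two] at hg1 ⊢
      clear hg' hV hc hcnc hcomm hw
      revert p q r s hd hg1; decide
    · right
      refine ⟨?_, by rw [Units.val_mul, Units.val_mul, Matrix.det_units_conj]; exact hd⟩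
      have hgc1 : Matrix.det ((g * c : GL (Fin 2) (ZMod 5)) : Matrix (Fin 2) (Fin 2) (ZMod 5)) = 1 :=
        det_mul_eq_one_of_det_eq_neg_one hd hcdet
      have hU := hcomm (g * c) (G.mul_mem hg hcG) hgc1
      obtain ⟨p, q, r, s, hgc⟩ := exists_eq_fin_two ((g * c : GL (Fin 2) (ZMod 5)) : Matrix (Fin 2) (Fin 2) (ZMod 5))
      rw [hgc, Matrix.det_fin_two_of] at hgc1
      rw [hgc] at hU
      have hU' : (!![0, 1; 1, 2] : Matrix (Fin 2) (Fin 2) (ZMod 5)) * !![p, q; r, s] * !![3, 1; 1, 0] * !![3, 1; 3, 3] =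
          !![3, 1; 3, 3] * ((!![0, 1; 1, 2] : Matrix (Fin 2) (Fin 2) (ZMod 5)) * !![p, q; r, s] * !![3, 1; 1, 0]) := by
        simp only [Matrix.mul_fin_two] at hU ⊢
        clear hgc hV hc hcnc hcomm hw
        revert p q r s hgc1 hU; decide
      have hg' : (g : Matrix (Fin 2) (Fin 2) (ZMod 5)) = !![p, q; r, s] * !![c1, c2; c3, c4] := by
        rw [← hgc, ← hc, ← Units.val_mul, mul_assoc, hcc, mul_one]
      rw [Units.val_mul, Units.val_mul, hg']
      change (!![0, 1; 1, 2] : Matrix (Fin 2) (Fin 2) (ZMod 5)) * (!![p, q; r, s] * !![c1, c2; c3, c4]) * !![3, 1; 1, 0] *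
          !![1, 0; 0, 4] * !![3, 1; 3, 3] =
        !![3, 1; 3, 3] * ((!![0, 1; 1, 2] : Matrix (Fin 2) (Fin 2) (ZMod 5)) * (!![p, q; r, s] * !![c1, c2; c3, c4]) *
          !![3, 1; 1, 0] * !![1, 0; 0, 4])
      exact conj_mul_comm_of_parts _ _ _ _ _ _ (by decide) hU' hV


/-! ## 9. The census -/

/-- **`GroupCensusFive` (route `Langlands/SqrtFiveQuarticCovers`, item stmt-Langlands-17592).**
Every subgroup `G ≤ GL₂(𝔽₅)` with `det G ⊆ {±1}`, containing an element of trace `0` and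
determinant `-1`, with no common `𝔽₅`-eigenline and whose determinant-one part does not span
`M₂(𝔽₅)`, is conjugate into `H8 = ⟨diag(2,3), antidiag(1,1)⟩` or into `H12 = ⟨(3 1;3 3), diag(1,4)⟩`
(Freitas–Le Hung–Siksek: "three subgroups of orders `6`, `8` and `12`").  Proof: a non-scalar
`g₀ ∈ G ∩ SL₂` exists (`FLS2015.exists_det_eq_one_ne_smul_one`: else `G` is abelian, commutes with
the involution `c` and fixes a line); put `g₀` in rational canonical form and transport the four
hypotheses along the conjugation; by the trace of `g₀`: `0` ↦ case B (`H8`), `1, 4` ↦ case A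
(`H12`), `2, 3` ↦ case C (impossible).  No enumeration of subgroups; every residual finite check
is a `decide` over at most six elements of `ZMod 5`.
[cite: FreitasLeHungSiksek2015, Remark (iii) after Cor. 2.1] -/
theorem groupCensusFive_proof :
    Summit.Langlands.Langlands.Theses.SqrtFiveQuarticCovers.GroupCensusFive := by
  intro G hdet hc hirr hspan
  obtain ⟨c, hcG, hctr, hcdet⟩ := hc
  obtain ⟨φ, hφ0, hφ⟩ := exists_functional hspan
  have hcc := mul_self_eq_one_of_trace_zero c hctr hcdet
  -- a non-scalar element of determinant one
  obtain ⟨g0, hg0G, hg0det, hg0ns⟩ : ∃ g ∈ G, Matrix.GeneralLinearGroup.det g = 1 ∧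
      ∀ s : ZMod 5, (g : Matrix (Fin 2) (Fin 2) (ZMod 5)) ≠ s • (1 : Matrix (Fin 2) (Fin 2) (ZMod 5)) := by
    haveI : Fact (Nat.Prime 5) := ⟨by norm_num⟩
    refine Literature.NumberTheory.GaloisRepresentations.FLS2015.exists_det_eq_one_ne_smul_one
      (G := G) (by decide) (fun v hv => ?_) hcG hcc (Units.ext (by simpa using hcdet))
    by_contra hall
    push Not at hall
    exact hirr ⟨v, hv, hall⟩
  have hg0det' : Matrix.det (g0 : Matrix (Fin 2) (Fin 2) (ZMod 5)) = 1 := by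
    have h := congr_arg Units.val hg0det
    simpa using h
  obtain ⟨P, hP⟩ := exists_conj_eq_normalForm g0 hg0det' hg0ns
  -- transport everything to `G' = P⁻¹ G P`, which contains the normal form of `g₀`
  have hdet' := det_transfer P⁻¹ hdet
  have hc' := odd_transfer P⁻¹ hcG hctr hcdet
  have hirr' := irr_transfer P⁻¹ hirr
  obtain ⟨φ', hφ0', hφ'⟩ := functional_transfer P⁻¹ φ hφ0 hφ
  have hnG : P⁻¹ * g0 * P⁻¹⁻¹ ∈ G.map (MulAut.conj P⁻¹).toMonoidHom := conj_mem_map_conj hg0G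
  have hnval : ((P⁻¹ * g0 * P⁻¹⁻¹ : GL (Fin 2) (ZMod 5)) : Matrix (Fin 2) (Fin 2) (ZMod 5)) =
      ((P⁻¹ : GL (Fin 2) (ZMod 5)) : Matrix (Fin 2) (Fin 2) (ZMod 5)) *
        (g0 : Matrix (Fin 2) (Fin 2) (ZMod 5)) * (P : Matrix (Fin 2) (Fin 2) (ZMod 5)) := by
    rw [inv_inv, Units.val_mul, Units.val_mul]
  refine concl_transfer P⁻¹ ?_
  rcases hP with h | h | h | h | h
  · exact caseB hdet' hc'.1 hc'.2.1 hc'.2.2 hirr' hφ0' hφ' hnG (hnval.trans h)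
  · exact caseA hdet' hc'.1 hc'.2.1 hc'.2.2 hφ0' hφ' (Or.inl rfl) hnG (hnval.trans h)
  · exact (caseC hdet' hc'.1 hc'.2.1 hc'.2.2 hirr' hφ0' hφ' (Or.inl rfl) hnG (hnval.trans h)).elim
  · exact (caseC hdet' hc'.1 hc'.2.1 hc'.2.2 hirr' hφ0' hφ' (Or.inr rfl) hnG (hnval.trans h)).elim
  · exact caseA hdet' hc'.1 hc'.2.1 hc'.2.2 hφ0' hφ' (Or.inr rfl) hnG (hnval.trans h)


/-! ## 10. Consumer: the crux `ReductionToRefinedLocus` modulo the three printed lifting theorems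
(item stmt-Langlands-17834; CONDITIONAL — `--supports`, does not close that item)

`ReductionToRefinedLocus`: for `K` totally real quartic with `√5 ∈ K` and `E / 𝓞 K` (`Δ ≠ 0`) NOT
modular (trace-only sense, written out), some framing of `E[3]` is Borel or in `C_s⁺(3)`, some
framing of `E[5]` is Borel or in `H8` or in `H12`, and some framing of `E[7]` is Borel or in `G(e7)`.
Assembled here from the tree's typed literature and the census just proved: the `3`- and `7`-clauses
are Box 2022 Thm. 7.1 (`Box2022.theorem7_1_of_not_isModularEllipticCurve h3 h4 hKal`; its coarse
Cartan `5`-clause is discarded); the `5`-clause is FLS Thm. 3 at `p = 5` with Remark (iii) after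
Cor. 2.1 (`FLS2015.modFive_image_of_not_isModularEllipticCurve h3`: a framing which is Borel, or whose
image has `det ⊆ {±1}`, an odd element, no `𝔽₅`-eigenline and non-spanning determinant-one part),
then `groupCensusFive_proof` on the image and the change of framing `FLS2015.isTorsionGaloisRep_conj`.
The three inputs are NAMED FACTS of the tree (deep modularity lifting theorems), cited, not proved —
a conditional result; nothing here proves modularity of any elliptic curve. -/

open Literature.NumberTheory.Automorphic Literature.NumberTheory.GaloisRepresentations in
/-- **`ReductionToRefinedLocus` holds modulo `FLS2015_theorem3`, `FLS2015_theorem4` and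
`Kalyanswamy2018_theorem1_2`** (route `Langlands/SqrtFiveQuarticCovers`, item stmt-Langlands-17834;
CONDITIONAL on the three named lifting facts).  Proof: `3`/`7` from
`Box2022.theorem7_1_of_not_isModularEllipticCurve`; `5` from
`FLS2015.modFive_image_of_not_isModularEllipticCurve`, the proved census `groupCensusFive_proof`
applied to the image `ρ̄(Γ_K)`, and the change of framing `FLS2015.isTorsionGaloisRep_conj`.
[cite: Box2022, Thm. 7.1] [cite: FreitasLeHungSiksek2015, Thm. 3 and Remark (iii) after Cor. 2.1] -/
theorem reductionToRefinedLocus_of_liftingTheorems (h3 : FLS2015_theorem3) (h4 : FLS2015_theorem4)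
    (hKal : Kalyanswamy2018_theorem1_2) :
    Summit.Langlands.Langlands.Theses.SqrtFiveQuarticCovers.ReductionToRefinedLocus := by
  intro K _ _ hK hdeg h5 E hE hne
  obtain ⟨h3c, -, h7c⟩ :=
    Box2022.theorem7_1_of_not_isModularEllipticCurve h3 h4 hKal K hK hdeg E hE hne
  refine ⟨h3c, ?_, h7c⟩
  obtain ⟨ρ, hρ, hB | ⟨ha, hb, hc, hd⟩⟩ :=
    FLS2015.modFive_image_of_not_isModularEllipticCurve h3 K hK h5 E hE hne
  · exact Or.inl ⟨ρ, hρ, hB⟩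
  · obtain ⟨x, hx⟩ := groupCensusFive_proof ρ.toMonoidHom.range ha hb hc hd
    have hρ' := FLS2015.isTorsionGaloisRep_conj hρ x
    rcases hx with h8 | h12
    · refine Or.inr ⟨FramedRep.conj x ρ, hρ', Or.inl fun σ => ?_⟩
      rw [FramedRep.conj_apply]
      exact h8 _ ⟨σ, rfl⟩
    · refine Or.inr ⟨FramedRep.conj x ρ, hρ', Or.inr fun σ => ?_⟩
      rw [FramedRep.conj_apply]
      exact h12 _ ⟨σ, rfl⟩


/-! ## 11. Two registered stubs of the crux skeleton `Cruxes/ReductionToRefinedLocus/Lines/birth.lean`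
(stmt-Langlands-17834), proved outright -/

/-- **A common `𝔽₅`-eigenline puts `G` into the Borel after conjugation.** If `v ≠ 0` is an
eigenvector of every `g ∈ G ≤ GL₂(𝔽₅)`, then for `P = [v | w]` invertible every `P⁻¹ g P` is upper
triangular (its first column is `P⁻¹ g v = a P⁻¹ v = a e₀`). [folklore] -/
theorem exists_conj_upper_of_eigenvector {G : Subgroup (GL (Fin 2) (ZMod 5))} {v : Fin 2 → ZMod 5}
    (hv : v ≠ 0) (hall : ∀ g ∈ G, ∃ a : ZMod 5,
      ((g : GL (Fin 2) (ZMod 5)) : Matrix (Fin 2) (Fin 2) (ZMod 5)) *ᵥ v = a • v) :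
    ∃ x : GL (Fin 2) (ZMod 5), ∀ g ∈ G,
      ((x * g * x⁻¹ : GL (Fin 2) (ZMod 5)) : Matrix (Fin 2) (Fin 2) (ZMod 5)) 1 0 = 0 := by
  -- complete `v` to a basis `(v, w)`
  obtain ⟨w, hdet⟩ : ∃ w : Fin 2 → ZMod 5, Matrix.det !![v 0, w 0; v 1, w 1] ≠ 0 := by
    by_cases h0 : v 0 = 0
    · have h1 : v 1 ≠ 0 := fun h1 => hv (by ext i; fin_cases i <;> simp [h0, h1])
      exact ⟨![1, 0], by rw [Matrix.det_fin_two_of]; simpa using h1⟩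
    · exact ⟨![0, 1], by rw [Matrix.det_fin_two_of]; simpa using h0⟩
  obtain ⟨P, hP⟩ : ∃ P : GL (Fin 2) (ZMod 5),
      (P : Matrix (Fin 2) (Fin 2) (ZMod 5)) = !![v 0, w 0; v 1, w 1] := by
    haveI : Fact (Nat.Prime 5) := ⟨by norm_num⟩
    exact ⟨Matrix.GeneralLinearGroup.mkOfDetNeZero _ hdet,
      Matrix.GeneralLinearGroup.val_mkOfDetNeZero _ _⟩
  refine ⟨P⁻¹, fun g hg => ?_⟩
  obtain ⟨a, ha⟩ := hall g hg
  have e0 := congr_fun ha 0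
  have e1 := congr_fun ha 1
  simp only [Matrix.mulVec, dotProduct, Fin.sum_univ_two, Pi.smul_apply, smul_eq_mul] at e0 e1
  have e2 := congr_fun (congr_fun (Units.inv_mul P :
    ((P⁻¹ : GL (Fin 2) (ZMod 5)) : Matrix (Fin 2) (Fin 2) (ZMod 5)) * P = 1) 1) 0
  rw [Matrix.mul_apply, Fin.sum_univ_two, Matrix.one_apply_ne (by decide), hP] at e2
  simp only [Matrix.of_apply, Matrix.cons_val', Matrix.cons_val_zero, Matrix.cons_val_one,
    Matrix.cons_val_fin_one, Matrix.empty_val'] at e2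
  rw [inv_inv, Units.val_mul, Units.val_mul, Matrix.mul_apply, Fin.sum_univ_two, Matrix.mul_apply,
    Matrix.mul_apply, Fin.sum_univ_two, Fin.sum_univ_two, hP]
  simp only [Matrix.of_apply, Matrix.cons_val', Matrix.cons_val_zero, Matrix.cons_val_one,
    Matrix.cons_val_fin_one, Matrix.empty_val']
  linear_combination ((P⁻¹ : GL (Fin 2) (ZMod 5)) : Matrix (Fin 2) (Fin 2) (ZMod 5)) 1 0 * e0 +
    ((P⁻¹ : GL (Fin 2) (ZMod 5)) : Matrix (Fin 2) (Fin 2) (ZMod 5)) 1 1 * e1 + a * e2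

/-- **Registered stub `stub_detSqrtFive` of line `birth` (stmt-Langlands-17834), PROVED:**
`√5 ∈ K ⇒ det ρ̄_{E,5}(Γ_K) ⊆ {±1}` for any framing `ρ̄` of `E[5]` — the tree theorem
`det_eq_one_or_eq_neg_one_of_isTorsionGaloisRep_of_isSquare_five` (Weil pairing `det ρ̄ = χ̄₅` and
`χ̄₅ ∈ {±1}` when `σ` fixes `√5`), unfolded to the route's written-out rendering.
[cite: FreitasLeHungSiksek2015, Remark (iii) after Cor. 2.1] -/
theorem stub_detSqrtFive : ∀ (K : Type) [Field K] [NumberField K], (∃ r : K, r ^ 2 = 5) → ∀ E : WeierstrassCurve (NumberField.RingOfIntegers K), E.Δ ≠ 0 → ∀ ρ : Literature.NumberTheory.GaloisRepresentations.FramedGaloisRep K (ZMod 5) 2, (∃ e : (E.baseChange K).geomTorsion ((5 : ℕ) : ℤ) ≃+ (Fin 2 → ZMod 5), ∀ (σ : Field.absoluteGaloisGroup K) (P : (E.baseChange K).geomTorsion ((5 : ℕ) : ℤ)), e (σ • P) = ((ρ σ : GL (Fin 2) (ZMod 5)) : Matrix (Fin 2) (Fin 2) (ZMod 5)) *ᵥ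 (e P)) → ∀ σ : Field.absoluteGaloisGroup K, Matrix.det ((ρ σ : GL (Fin 2) (ZMod 5)) : Matrix (Fin 2) (Fin 2) (ZMod 5)) = 1 ∨ Matrix.det ((ρ σ : GL (Fin 2) (ZMod 5)) : Matrix (Fin 2) (Fin 2) (ZMod 5)) = -1 := by
  intro K _ _ h5 E hE ρ hρ σ
  haveI : Fact (Nat.Prime 5) := ⟨by norm_num⟩
  haveI := Literature.NumberTheory.Automorphic.FLS2015.isElliptic_baseChange hE
  obtain ⟨r, hr⟩ := h5
  exact Literature.NumberTheory.Automorphic.det_eq_one_or_eq_neg_one_of_isTorsionGaloisRep_of_isSquare_five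
    ⟨r, by rw [← sq, hr]⟩ (E.baseChange K) hρ σ

/-- **Registered stub `stub_censusTrichotomy` of line `birth` (stmt-Langlands-17834), PROVED:** every
`G ≤ GL₂(𝔽₅)` with `det G ⊆ {±1}`, an element of trace `0` and determinant `-1`, and non-spanning
determinant-one part is conjugate into the Borel, or into `H8`, or into `H12`.  The reducible case
(a common `𝔽₅`-eigenline) is `exists_conj_upper_of_eigenvector`; the irreducible case is exactly
`groupCensusFive_proof`. [cite: FreitasLeHungSiksek2015, Remark (iii) after Cor. 2.1 and Lemma 3.2] -/
theorem stub_censusTrichotomy : ∀ G : Subgroup (GL (Fin 2) (ZMod 5)), (∀ g ∈ G, Matrix.det ((g : GL (Fin 2) (ZMod 5)) : Matrix (Fin 2) (Fin 2) (ZMod 5)) = 1 ∨ Matrix.det ((g : GL (Fin 2) (ZMod 5)) : Matrix (Fin 2) (Fin 2) (ZMod 5)) = -1) → (∃ c ∈ G, Matrix.trace ((c : GL (Fin 2) (ZMod 5)) : Matrix (Fin 2) (Fin 2) (ZMod 5)) = 0 ∧ Matrix.det ((c : GL (Fin 2) (ZMod 5)) : Matrix (Fin 2) (Fin 2) (ZMod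 5)) = -1) → Submodule.span (ZMod 5) ((fun g : GL (Fin 2) (ZMod 5) => ((g : GL (Fin 2) (ZMod 5)) : Matrix (Fin 2) (Fin 2) (ZMod 5))) '' {g : GL (Fin 2) (ZMod 5) | g ∈ G ∧ Matrix.det ((g : GL (Fin 2) (ZMod 5)) : Matrix (Fin 2) (Fin 2) (ZMod 5)) = 1}) ≠ ⊤ → ∃ x : GL (Fin 2) (ZMod 5), (∀ g ∈ G, ((x * g * x⁻¹ : GL (Fin 2) (ZMod 5)) : Matrix (Fin 2) (Fin 2) (ZMod 5)) 1 0 = 0) ∨ (∀ g ∈ G, x * g * x⁻¹ ∈ Subgroup.closure ({(⟨!![2, 0; 0, 3], !![3, 0; 0, 2], by decide, by decide⟩ : GL (Fin 2) (ZMod 5)), (⟨!![0, 1; 1, 0], !![0, 1; 1, 0], by decide, by decide⟩ : GL (Fin 2) (ZMod 5))} : Set (GL (Fin 2) (ZMod 5)))) ∨ (∀ g ∈ G, x * g * x⁻¹ ∈ Subgroup.closure ({(⟨!![3, 1; 3, 3], !![3, 4; 2, 3], by decide, by decide⟩ : GL (Fin 2) (ZMod 5)), (⟨!![1, 0; 0,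 4], !![1, 0; 0, 4], by decide, by decide⟩ : GL (Fin 2) (ZMod 5))} : Set (GL (Fin 2) (ZMod 5)))) := by
  intro G hdet hc hspan
  by_cases hirr : ∃ v : Fin 2 → ZMod 5, v ≠ 0 ∧ ∀ g ∈ G, ∃ a : ZMod 5,
      ((g : GL (Fin 2) (ZMod 5)) : Matrix (Fin 2) (Fin 2) (ZMod 5)) *ᵥ v = a • v
  · obtain ⟨v, hv, hall⟩ := hirr
    obtain ⟨x, hx⟩ := exists_conj_upper_of_eigenvector hv hall
    exact ⟨x, Or.inl hx⟩
  · obtain ⟨x, hx⟩ := groupCensusFive_proof G hdet hc hirr hspan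
    rcases hx with h8 | h12
    · exact ⟨x, Or.inr (Or.inl h8)⟩
    · exact ⟨x, Or.inr (Or.inr h12)⟩

end Summit.Langlands.Langlands.Theorems.GroupCensusFive
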